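import Literature.Analysis.FluidPDE.PassiveScalarDiagMildTransport
import HarnessLib

/-!
# Mild (Duhamel) formulation of the passive scalar equation with constant diagonal diffusion and
  bounded drift, III: the Duhamel bounds

Analysis/FluidPDE proof-support file (everything proved), sequel of `PassiveScalarDiagMildTransport`.
The `L²_t H⁻¹_x → L^∞_t L²_x` estimate behind the contraction, mode by mode and summed (Pazy 1983,
Ch. 4 §4.2 for the mild formulation; the estimate is the elementary energy-type bound for the heat
semigroup applied to a divergence, Evans 2010 §7.1.2): with the transport weight
`g(θ)(s)(k) = ∑ⱼ aⱼ⁻¹ ‖𝓕(uⱼ(s)θ(s))(k)‖²` (`Torus.transportWeight`; `∑_{k∈F} g ≤ (∑ⱼaⱼ⁻¹)U²E` by Bessel),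

* `‖D^λ(θ)(t)(k)‖² ≤ (2κ)⁻¹ ∫_{(0,t]} e^{-λ(t-s)} g(θ)(s)(k) ds` (`norm_sq_duhamelCoeff_le`: Cauchy–Schwarz
  in time, `‖Nₖ‖ ≤ 2πQₐ(k)^{1/2} gₖ^{1/2}` and `∫₀ᵗ 4π²Qₐ(k)e^{-(2νₖ+λ)(t-s)}ds ≤ 4π²Qₐ(k)/(2νₖ+λ) ≤ (2κ)⁻¹`,
  `νₖ = 4π²κQₐ(k)`: the heat factor regains the derivative uniformly in the frequency);
* summed over a finite frequency set, and **the contraction bound**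
  `∑_{k∈F} ‖D^λ(θ)(t)(k)‖² ≤ (∑ⱼaⱼ⁻¹) U² E / (2κλ)` for all `t ∈ [0,T]`
  (`sum_norm_sq_duhamelCoeff_le_const`).

## References

* A. Pazy, *Semigroups of Linear Operators and Applications to Partial Differential Equations*,
  Springer 1983, Ch. 4 §4.2 (mild solutions, Duhamel's formula (2.3), Def. 2.3, Cor. 2.5).
* L. C. Evans, *Partial Differential Equations*, 2nd ed. (AMS 2010), §7.1.2–7.1.3.
* R. J. DiPerna, P.-L. Lions, Invent. Math. 98 (1989) 511–547, §II.1 (the weak class).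
* L. Grafakos, *Classical Fourier Analysis*, 3rd ed. (2014), Prop. 3.2.6 (4), (8), Prop. 3.2.7 (3).
-/

noncomputable section

open MeasureTheory TopologicalSpace Set Function Filter UnitAddTorus
open _root_.Topology
open scoped ENNReal NNReal InnerProductSpace ComplexConjugate

namespace Literature.Analysis.FluidPDE

namespace Torus

open Literature.Analysis.FunctionSpaces.Torus Literature.Analysis.FunctionSpaces

variable {d : Type*} [Fintype d]

/-! ## The transport weight and the Duhamel bounds -/

section Bounds

variable {T U E κ lam : ℝ} {a : d → ℝ} {u : ℝ → UnitAddTorus d → EuclideanSpace ℝ d}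
  {θ : ℝ → UnitAddTorus d → ℝ}

/-- The **transport weight** `g(θ)(s)(k) = ∑ⱼ aⱼ⁻¹ ‖𝓕(uⱼ(s)θ(s))(k)‖²` (the quantity whose sum over
`k` is `∑ⱼ aⱼ⁻¹ ‖uⱼ(s)θ(s)‖²_{L²} ≤ (∑ⱼaⱼ⁻¹) ‖u‖²_∞ ‖θ(s)‖²_{L²}` by Parseval). [cite: Grafakos2014, Prop. 3.2.7 (3)] -/
def transportWeight (a : d → ℝ) (u : ℝ → UnitAddTorus d → EuclideanSpace ℝ d)
    (θ : ℝ → UnitAddTorus d → ℝ) (s : ℝ) (k : d → ℤ) : ℝ :=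
  ∑ j, (a j)⁻¹ * ‖mFourierCoeff (fun x => ((u s x j * θ s x : ℝ) : ℂ)) k‖ ^ 2

/-- Unfolding `transportWeight`. [cite: Grafakos2014, Prop. 3.2.7 (3)] -/
theorem transportWeight_apply (a : d → ℝ) (u : ℝ → UnitAddTorus d → EuclideanSpace ℝ d)
    (θ : ℝ → UnitAddTorus d → ℝ) (s : ℝ) (k : d → ℤ) :
    transportWeight a u θ s k = ∑ j, (a j)⁻¹ * ‖mFourierCoeff (fun x => ((u s x j * θ s x : ℝ) : ℂ)) k‖ ^ 2 :=
  rfl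

/-- The transport weight is nonnegative (`aⱼ > 0`). [cite: Grafakos2014, Prop. 3.2.7 (3)] -/
theorem transportWeight_nonneg (ha : ∀ i, 0 < a i) (u : ℝ → UnitAddTorus d → EuclideanSpace ℝ d)
    (θ : ℝ → UnitAddTorus d → ℝ) (s : ℝ) (k : d → ℤ) : 0 ≤ transportWeight a u θ s k :=
  Finset.sum_nonneg fun j _ => mul_nonneg (inv_nonneg.2 (ha j).le) (sq_nonneg _)

/-- The transport weight is a.e. strongly measurable in time on `(0,T)`. [cite: DiPernaLions1989, §II.1 (12)–(14)] -/
theorem aestronglyMeasurable_transportWeight (hu : DriftBound T u U) (hθ : IsL2Field T E θ) (k : d → ℤ) :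
    AEStronglyMeasurable (fun s => transportWeight a u θ s k) ((volume : Measure ℝ).restrict (Ioo 0 T)) := by
  simp only [transportWeight]
  refine Finset.aestronglyMeasurable_fun_sum _ fun j _ => ?_
  exact ((integrable_mFourierCoeff_apply_mul hu hθ j k).aestronglyMeasurable.norm.pow 2).const_mul _

/-- **Single-mode Bessel**: `‖𝓕(f)(k)‖² ≤ ∫ f²` for `f ∈ L²(T^d; ℝ)`. [cite: Grafakos2014, Prop. 3.2.7 (3)] -/
theorem sq_norm_mFourierCoeff_le_integral_sq {f : UnitAddTorus d → ℝ} (hf : MemLp f 2 volume) (k : d → ℤ) :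
    ‖mFourierCoeff (fun x => (f x : ℂ)) k‖ ^ 2 ≤ ∫ x, f x ^ 2 :=
  le_hasSum (hasSum_sq_norm_mFourierCoeff_ofReal hf) k fun _ _ => sq_nonneg _

/-- **The a.e. bound on the transport weight**: for a.e. `s ∈ (0,T)` and every `k`,
`g(θ)(s)(k) ≤ (∑ⱼ aⱼ⁻¹) U² E`. [cite: Grafakos2014, Prop. 3.2.7 (3)] -/
theorem ae_transportWeight_le (hu : DriftBound T u U) (hθ : IsL2Field T E θ) (ha : ∀ i, 0 < a i) :
    ∀ᵐ s ∂((volume : Measure ℝ).restrict (Ioo 0 T)), ∀ k,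
      transportWeight a u θ s k ≤ (∑ j, (a j)⁻¹) * (U ^ 2 * E) := by
  have h : ∀ᵐ s ∂((volume : Measure ℝ).restrict (Ioo 0 T)), ∀ j,
      MemLp (fun x => u s x j * θ s x) 2 volume ∧ ∫ x, (u s x j * θ s x) ^ 2 ≤ U ^ 2 * E := by
    rw [eventually_all]
    exact fun j => ae_memLp_apply_mul hu hθ j
  filter_upwards [h] with s hs k
  rw [transportWeight_apply, Finset.sum_mul]
  refine Finset.sum_le_sum fun j _ => ?_
  refine mul_le_mul_of_nonneg_left ?_ (inv_nonneg.2 (ha j).le)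
  exact (sq_norm_mFourierCoeff_le_integral_sq (hs j).1 k).trans (hs j).2

/-- **Bessel for the transport weight**: for a.e. `s ∈ (0,T)` and every finite `F`,
`∑_{k∈F} g(θ)(s)(k) ≤ (∑ⱼ aⱼ⁻¹) U² E`. [cite: Grafakos2014, Prop. 3.2.7 (3)] -/
theorem ae_sum_transportWeight_le (hu : DriftBound T u U) (hθ : IsL2Field T E θ) (ha : ∀ i, 0 < a i) :
    ∀ᵐ s ∂((volume : Measure ℝ).restrict (Ioo 0 T)), ∀ F : Finset (d → ℤ),
      ∑ k ∈ F, transportWeight a u θ s k ≤ (∑ j, (a j)⁻¹) * (U ^ 2 * E) := by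
  have h : ∀ᵐ s ∂((volume : Measure ℝ).restrict (Ioo 0 T)), ∀ j,
      MemLp (fun x => u s x j * θ s x) 2 volume ∧ ∫ x, (u s x j * θ s x) ^ 2 ≤ U ^ 2 * E := by
    rw [eventually_all]
    exact fun j => ae_memLp_apply_mul hu hθ j
  filter_upwards [h] with s hs F
  simp only [transportWeight_apply]
  rw [Finset.sum_comm, Finset.sum_mul]
  refine Finset.sum_le_sum fun j _ => ?_
  rw [← Finset.mul_sum]
  refine mul_le_mul_of_nonneg_left ?_ (inv_nonneg.2 (ha j).le)
  exact (sum_le_hasSum F (fun _ _ => sq_nonneg _) (hasSum_sq_norm_mFourierCoeff_ofReal (hs j).1)).trans (hs j).2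

/-- The transport weight is integrable in time on `(0,T)`. [cite: DiPernaLions1989, §II.1 (12)–(14)] -/
theorem integrable_transportWeight (hu : DriftBound T u U) (hθ : IsL2Field T E θ) (ha : ∀ i, 0 < a i)
    (k : d → ℤ) :
    Integrable (fun s => transportWeight a u θ s k) ((volume : Measure ℝ).restrict (Ioo 0 T)) := by
  haveI : IsFiniteMeasure ((volume : Measure ℝ).restrict (Ioo 0 T)) :=
    isFiniteMeasure_restrict.2 measure_Ioo_lt_top.ne
  refine Integrable.of_bound (aestronglyMeasurable_transportWeight hu hθ k) ((∑ j, (a j)⁻¹) * (U ^ 2 * E)) ?_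
  filter_upwards [ae_transportWeight_le hu hθ ha] with s hs
  rw [Real.norm_of_nonneg (transportWeight_nonneg ha u θ s k)]
  exact hs k

/-- Cauchy–Schwarz for nonnegative `L²` functions on a finite measure space (real line). [folklore] -/
private theorem integral_mul_le_sqrt_mul_sqrt {μ : Measure ℝ} [IsFiniteMeasure μ] {φ ψ : ℝ → ℝ}
    (hφ : MemLp φ 2 μ) (hψ : MemLp ψ 2 μ) (hφ0 : 0 ≤ᵐ[μ] φ) (hψ0 : 0 ≤ᵐ[μ] ψ) :
    ∫ s, φ s * ψ s ∂μ ≤ Real.sqrt (∫ s, φ s ^ 2 ∂μ) * Real.sqrt (∫ s, ψ s ^ 2 ∂μ) := by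
  have hφ' : MemLp φ (ENNReal.ofReal 2) μ := by simpa using hφ
  have hψ' : MemLp ψ (ENNReal.ofReal 2) μ := by simpa using hψ
  have hH := integral_mul_le_Lp_mul_Lq_of_nonneg Real.HolderConjugate.two_two hφ0 hψ0 hφ' hψ'
  rw [Real.sqrt_eq_rpow, Real.sqrt_eq_rpow]
  have e1 : ∫ s, φ s ^ (2 : ℝ) ∂μ = ∫ s, φ s ^ 2 ∂μ :=
    integral_congr_ae (ae_of_all _ fun s => by dsimp only; rw [Real.rpow_two])
  have e2 : ∫ s, ψ s ^ (2 : ℝ) ∂μ = ∫ s, ψ s ^ 2 ∂μ :=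
    integral_congr_ae (ae_of_all _ fun s => by dsimp only; rw [Real.rpow_two])
  rw [e1, e2] at hH
  exact hH

/-- `∫_{(0,t]} e^{-c(t-s)} ds ≤ 1/c` for `c > 0`. [cite: Pazy1983, Ch. 4 §4.2, (2.3) and Def. 2.3 (mild solution), p. 106] -/
theorem integral_Ioc_exp_neg_mul_sub_le {c t : ℝ} (hc : 0 < c) :
    ∫ s in Ioc 0 t, Real.exp (-(c * (t - s))) ≤ c⁻¹ := by
  rcases le_or_gt t 0 with ht | ht
  · rw [Ioc_eq_empty (not_lt.2 ht), Measure.restrict_empty, integral_zero_measure]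
    exact inv_nonneg.2 hc.le
  have hderiv : ∀ s ∈ uIcc 0 t, HasDerivAt (fun s => c⁻¹ * Real.exp (-(c * (t - s))))
      (Real.exp (-(c * (t - s)))) s := by
    intro s _
    have h1 : HasDerivAt (fun s => -(c * (t - s))) c s := by
      have e : (fun s => -(c * (t - s))) = fun s => c * s + -(c * t) := by funext s; ring
      rw [e]
      simpa using ((hasDerivAt_id s).const_mul c).add_const (-(c * t))
    have h2 := (h1.exp).const_mul c⁻¹
    refine h2.congr_deriv ?_
    rw [mul_comm (Real.exp _) c, ← mul_assoc, inv_mul_cancel₀ hc.ne', one_mul]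
  have hcont : IntervalIntegrable (fun s => Real.exp (-(c * (t - s)))) volume 0 t :=
    (Real.continuous_exp.comp ((continuous_const.mul (continuous_const.sub continuous_id)).neg)).intervalIntegrable _ _
  rw [← intervalIntegral.integral_of_le ht.le, intervalIntegral.integral_eq_sub_of_hasDerivAt hderiv hcont]
  simp only [sub_self, mul_zero, neg_zero, Real.exp_zero, mul_one]
  have : 0 < c⁻¹ * Real.exp (-(c * (t - 0))) := mul_pos (inv_pos.2 hc) (Real.exp_pos _)
  linarith

/-- `‖N(θ)(s)(k)‖ ≤ 2π Qₐ(k)^{1/2} g(θ)(s)(k)^{1/2}` (square root of `norm_sq_transportCoeff_le`). [cite: Grafakos2014, Prop. 3.2.6 (8)] -/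
theorem norm_transportCoeff_le (ha : ∀ i, 0 < a i) (u : ℝ → UnitAddTorus d → EuclideanSpace ℝ d)
    (θ : ℝ → UnitAddTorus d → ℝ) (s : ℝ) (k : d → ℤ) :
    ‖transportCoeff u θ s k‖ ≤
      2 * Real.pi * Real.sqrt (diagFreqSq a k) * Real.sqrt (transportWeight a u θ s k) := by
  have h := norm_sq_transportCoeff_le ha u θ s k
  rw [← transportWeight_apply] at h
  have hQ0 : 0 ≤ diagFreqSq a k := diagFreqSq_nonneg (fun i => (ha i).le) k
  have hg0 : 0 ≤ transportWeight a u θ s k := transportWeight_nonneg ha u θ s k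
  have hrhs : 0 ≤ 2 * Real.pi * Real.sqrt (diagFreqSq a k) * Real.sqrt (transportWeight a u θ s k) := by
    positivity
  rw [← pow_le_pow_iff_left₀ (norm_nonneg _) hrhs two_ne_zero]
  calc ‖transportCoeff u θ s k‖ ^ 2 ≤ 4 * Real.pi ^ 2 * diagFreqSq a k * transportWeight a u θ s k := h
    _ = (2 * Real.pi * Real.sqrt (diagFreqSq a k) * Real.sqrt (transportWeight a u θ s k)) ^ 2 := by
        rw [mul_pow, mul_pow, mul_pow, Real.sq_sqrt hQ0, Real.sq_sqrt hg0]
        ring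

/-- **The single-mode Duhamel bound** (Cauchy–Schwarz in time; the heat factor regains the
derivative uniformly in the frequency): for `κ > 0`, `λ > 0`, `aᵢ > 0`, `t ∈ [0,T]`,
`‖D^λ(θ)(t)(k)‖² ≤ (2κ)⁻¹ ∫_{(0,t]} e^{-λ(t-s)} g(θ)(s)(k) ds`, using
`‖Nₖ(s)‖ ≤ 2π Qₐ(k)^{1/2} gₖ(s)^{1/2}` and `∫₀ᵗ 4π²Qₐ(k) e^{-(2νₖ+λ)(t-s)} ds ≤ 4π²Qₐ(k)/(2νₖ+λ) ≤ 1/(2κ)`. [cite: Evans2010, §7.1.2 Thm. 2 (energy estimates), with Pazy1983 Ch. 4 §4.2 (2.3)] -/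
theorem norm_sq_duhamelCoeff_le (hu : DriftBound T u U) (hθ : IsL2Field T E θ) (ha : ∀ i, 0 < a i)
    (hκ : 0 < κ) (hlam : 0 < lam) {t : ℝ} (ht : t ∈ Icc 0 T) (k : d → ℤ) :
    ‖duhamelCoeff κ a lam u θ t k‖ ^ 2 ≤
      (2 * κ)⁻¹ * ∫ s in Ioc 0 t, Real.exp (-(lam * (t - s))) * transportWeight a u θ s k := by
  set μ : Measure ℝ := (volume : Measure ℝ).restrict (Ioc 0 t) with hμ
  haveI : IsFiniteMeasure μ := by rw [hμ]; exact isFiniteMeasure_restrict.2 measure_Ioc_lt_top.ne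
  set ν := diagRate κ a k with hν
  set Q := diagFreqSq a k with hQ
  set Cg : ℝ := (∑ j, (a j)⁻¹) * (U ^ 2 * E) with hCg
  have hQ0 : 0 ≤ Q := diagFreqSq_nonneg (fun i => (ha i).le) k
  have hν0 : 0 ≤ ν := diagRate_nonneg hκ.le (fun i => (ha i).le) k
  have hνQ : ν = 4 * Real.pi ^ 2 * κ * Q := rfl
  -- the weight on `(0,t]`
  have hgw : ∀ᵐ s ∂μ, ∀ k, transportWeight a u θ s k ≤ Cg :=
    ae_restrict_Ioc_of_ae_restrict_Ioo ht.2 (ae_transportWeight_le hu hθ ha)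
  have hle : μ ≤ (volume : Measure ℝ).restrict (Ioo 0 T) := by
    rw [hμ, ← Measure.restrict_congr_set (Ioo_ae_eq_Ioc (μ := (volume : Measure ℝ)))]
    exact Measure.restrict_mono (Ioo_subset_Ioo_right ht.2) le_rfl
  have hgm : AEStronglyMeasurable (fun s => transportWeight a u θ s k) μ :=
    (aestronglyMeasurable_transportWeight hu hθ k).mono_measure hle
  have hsI : ∀ᵐ s ∂μ, s ∈ Ioc 0 t := ae_restrict_mem measurableSet_Ioc
  -- the two Cauchy–Schwarz factors
  set φ : ℝ → ℝ := fun s => 2 * Real.pi * Real.sqrt Q * Real.exp (-((ν + lam / 2) * (t - s))) with hφ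
  set ψ : ℝ → ℝ := fun s => Real.exp (-(lam / 2 * (t - s))) * Real.sqrt (transportWeight a u θ s k)
    with hψ
  have hφc : Continuous φ := by simp only [hφ]; fun_prop
  have hψm : AEStronglyMeasurable ψ μ :=
    ((by fun_prop : Continuous fun s => Real.exp (-(lam / 2 * (t - s)))).aestronglyMeasurable).mul
      (Real.continuous_sqrt.comp_aestronglyMeasurable hgm)
  have hφ0 : ∀ s, 0 ≤ φ s := fun s => by simp only [hφ]; positivity
  have hψ0 : ∀ s, 0 ≤ ψ s := fun s => by simp only [hψ]; positivity
  have hexp_le_one : ∀ {c : ℝ}, 0 ≤ c → ∀ s ∈ Ioc 0 t, Real.exp (-(c * (t - s))) ≤ 1 := by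
    intro c hc s hs
    rw [Real.exp_le_one_iff, neg_nonpos]
    exact mul_nonneg hc (by linarith [hs.2])
  have hφb : ∀ᵐ s ∂μ, ‖φ s‖ ≤ 2 * Real.pi * Real.sqrt Q := by
    filter_upwards [hsI] with s hs
    rw [Real.norm_of_nonneg (hφ0 s)]
    simp only [hφ]
    calc 2 * Real.pi * Real.sqrt Q * Real.exp (-((ν + lam / 2) * (t - s)))
        ≤ 2 * Real.pi * Real.sqrt Q * 1 :=
          mul_le_mul_of_nonneg_left (hexp_le_one (by positivity) s hs) (by positivity)
      _ = 2 * Real.pi * Real.sqrt Q := mul_one _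
  have hψb : ∀ᵐ s ∂μ, ‖ψ s‖ ≤ Real.sqrt Cg := by
    filter_upwards [hsI, hgw] with s hs hsw
    rw [Real.norm_of_nonneg (hψ0 s)]
    simp only [hψ]
    calc Real.exp (-(lam / 2 * (t - s))) * Real.sqrt (transportWeight a u θ s k)
        ≤ 1 * Real.sqrt Cg :=
          mul_le_mul (hexp_le_one (by positivity) s hs) (Real.sqrt_le_sqrt (hsw k))
            (Real.sqrt_nonneg _) zero_le_one
      _ = Real.sqrt Cg := one_mul _
  have hφ2 : MemLp φ 2 μ := MemLp.of_bound hφc.aestronglyMeasurable _ hφb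
  have hψ2 : MemLp ψ 2 μ := MemLp.of_bound hψm _ hψb
  -- Step 1: `‖D‖ ≤ ∫ φ ψ`
  have hstep1 : ‖duhamelCoeff κ a lam u θ t k‖ ≤ ∫ s, φ s * ψ s ∂μ := by
    rw [duhamelCoeff_apply]
    refine (norm_integral_le_integral_norm _).trans ?_
    refine integral_mono_ae (integrableOn_kernel_mul_transportCoeff hu hθ ht.2 k).norm
      (hφ2.integrable_mul hψ2) (ae_of_all _ fun s => ?_)
    dsimp only
    rw [norm_mul, Complex.norm_real, Real.norm_of_nonneg (Real.exp_pos _).le]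
    calc Real.exp (-((ν + lam) * (t - s))) * ‖transportCoeff u θ s k‖
        ≤ Real.exp (-((ν + lam) * (t - s))) * (2 * Real.pi * Real.sqrt Q *
            Real.sqrt (transportWeight a u θ s k)) :=
          mul_le_mul_of_nonneg_left (norm_transportCoeff_le ha u θ s k) (Real.exp_pos _).le
      _ = φ s * ψ s := by
          simp only [hφ, hψ]
          have : Real.exp (-((ν + lam) * (t - s))) =
              Real.exp (-((ν + lam / 2) * (t - s))) * Real.exp (-(lam / 2 * (t - s))) := by
            rw [← Real.exp_add]; congr 1; ring
          rw [this]; ring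
  -- Step 2: Cauchy–Schwarz
  have hstep2 : ∫ s, φ s * ψ s ∂μ ≤ Real.sqrt (∫ s, φ s ^ 2 ∂μ) * Real.sqrt (∫ s, ψ s ^ 2 ∂μ) :=
    integral_mul_le_sqrt_mul_sqrt hφ2 hψ2 (ae_of_all _ hφ0) (ae_of_all _ hψ0)
  -- Step 3: `∫ φ² ≤ (2κ)⁻¹`
  have hA : ∫ s, φ s ^ 2 ∂μ ≤ (2 * κ)⁻¹ := by
    have e : ∀ s, φ s ^ 2 = 4 * Real.pi ^ 2 * Q * Real.exp (-((2 * ν + lam) * (t - s))) := by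
      intro s
      simp only [hφ]
      rw [mul_pow, mul_pow, mul_pow, Real.sq_sqrt hQ0, ← Real.exp_nat_mul]
      congr 1
      · ring
      · congr 1; push_cast; ring
    simp_rw [e]
    rw [integral_const_mul]
    have h2νl : 0 < 2 * ν + lam := by positivity
    calc 4 * Real.pi ^ 2 * Q * ∫ s, Real.exp (-((2 * ν + lam) * (t - s))) ∂μ
        ≤ 4 * Real.pi ^ 2 * Q * (2 * ν + lam)⁻¹ :=
          mul_le_mul_of_nonneg_left (integral_Ioc_exp_neg_mul_sub_le h2νl) (by positivity)
      _ ≤ (2 * κ)⁻¹ := by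
          rw [← div_eq_mul_inv, inv_eq_one_div, div_le_div_iff₀ h2νl (by positivity), one_mul, hνQ]
          have : 4 * Real.pi ^ 2 * Q * (2 * κ) = 2 * (4 * Real.pi ^ 2 * κ * Q) := by ring
          linarith
  -- Step 4: `∫ ψ² = ∫ e^{-λ(t-s)} g`
  have hB : ∫ s, ψ s ^ 2 ∂μ = ∫ s, Real.exp (-(lam * (t - s))) * transportWeight a u θ s k ∂μ := by
    refine integral_congr_ae (ae_of_all _ fun s => ?_)
    simp only [hψ]
    rw [mul_pow, Real.sq_sqrt (transportWeight_nonneg ha u θ s k), ← Real.exp_nat_mul]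
    congr 2
    push_cast; ring
  -- conclusion
  have hA0 : 0 ≤ ∫ s, φ s ^ 2 ∂μ := integral_nonneg fun s => sq_nonneg _
  have hB0 : 0 ≤ ∫ s, ψ s ^ 2 ∂μ := integral_nonneg fun s => sq_nonneg _
  have hD0 : 0 ≤ ‖duhamelCoeff κ a lam u θ t k‖ := norm_nonneg _
  calc ‖duhamelCoeff κ a lam u θ t k‖ ^ 2 ≤ (∫ s, φ s * ψ s ∂μ) ^ 2 :=
        pow_le_pow_left₀ hD0 hstep1 2
    _ ≤ (Real.sqrt (∫ s, φ s ^ 2 ∂μ) * Real.sqrt (∫ s, ψ s ^ 2 ∂μ)) ^ 2 :=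
        pow_le_pow_left₀ (hD0.trans hstep1) hstep2 2
    _ = (∫ s, φ s ^ 2 ∂μ) * ∫ s, ψ s ^ 2 ∂μ := by
        rw [mul_pow, Real.sq_sqrt hA0, Real.sq_sqrt hB0]
    _ ≤ (2 * κ)⁻¹ * ∫ s, ψ s ^ 2 ∂μ := mul_le_mul_of_nonneg_right hA hB0
    _ = (2 * κ)⁻¹ * ∫ s, Real.exp (-(lam * (t - s))) * transportWeight a u θ s k ∂μ := by rw [hB]

/-- The damped weight `e^{-λ(t-s)} g(θ)(s)(k)` is integrable on `(0,t]`, `t ≤ T`. [cite: Pazy1983, Ch. 4 §4.2, (2.3) and Def. 2.3 (mild solution), p. 106] -/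
theorem integrableOn_exp_mul_transportWeight (hu : DriftBound T u U) (hθ : IsL2Field T E θ)
    (ha : ∀ i, 0 < a i) {t : ℝ} (ht : t ∈ Icc 0 T) (k : d → ℤ) :
    IntegrableOn (fun s => Real.exp (-(lam * (t - s))) * transportWeight a u θ s k) (Ioc 0 t) volume := by
  have hle : (volume : Measure ℝ).restrict (Ioc 0 t) ≤ (volume : Measure ℝ).restrict (Ioo 0 T) := by
    rw [← Measure.restrict_congr_set (Ioo_ae_eq_Ioc (μ := (volume : Measure ℝ)))]
    exact Measure.restrict_mono (Ioo_subset_Ioo_right ht.2) le_rfl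
  have hg : Integrable (fun s => transportWeight a u θ s k) ((volume : Measure ℝ).restrict (Ioc 0 t)) :=
    (integrable_transportWeight hu hθ ha k).mono_measure hle
  refine hg.bdd_mul (c := Real.exp (|lam| * (|t| + |t|)))
    ((by fun_prop : Continuous fun s => Real.exp (-(lam * (t - s)))).aestronglyMeasurable) ?_
  filter_upwards [ae_restrict_mem measurableSet_Ioc] with s hs
  rw [Real.norm_of_nonneg (Real.exp_pos _).le, Real.exp_le_exp]
  have hs' : |t - s| ≤ |t| + |t| := by
    refine (abs_sub _ _).trans (add_le_add le_rfl ?_)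
    rw [abs_of_nonneg hs.1.le]; exact hs.2.trans (le_abs_self t)
  calc -(lam * (t - s)) ≤ |lam * (t - s)| := neg_le_abs _
    _ = |lam| * |t - s| := abs_mul _ _
    _ ≤ |lam| * (|t| + |t|) := mul_le_mul_of_nonneg_left hs' (abs_nonneg _)

/-- **The Duhamel bound summed over a finite frequency set**:
`∑_{k∈F} ‖D^λ(θ)(t)(k)‖² ≤ (2κ)⁻¹ ∫_{(0,t]} e^{-λ(t-s)} ∑_{k∈F} g(θ)(s)(k) ds`. [cite: Evans2010, §7.1.2 Thm. 2 (energy estimates), with Pazy1983 Ch. 4 §4.2 (2.3)] -/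
theorem sum_norm_sq_duhamelCoeff_le (hu : DriftBound T u U) (hθ : IsL2Field T E θ) (ha : ∀ i, 0 < a i)
    (hκ : 0 < κ) (hlam : 0 < lam) {t : ℝ} (ht : t ∈ Icc 0 T) (F : Finset (d → ℤ)) :
    ∑ k ∈ F, ‖duhamelCoeff κ a lam u θ t k‖ ^ 2 ≤
      (2 * κ)⁻¹ * ∫ s in Ioc 0 t, Real.exp (-(lam * (t - s))) * ∑ k ∈ F, transportWeight a u θ s k := by
  calc ∑ k ∈ F, ‖duhamelCoeff κ a lam u θ t k‖ ^ 2
      ≤ ∑ k ∈ F, (2 * κ)⁻¹ * ∫ s in Ioc 0 t, Real.exp (-(lam * (t - s))) * transportWeight a u θ s k :=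
        Finset.sum_le_sum fun k _ => norm_sq_duhamelCoeff_le hu hθ ha hκ hlam ht k
    _ = (2 * κ)⁻¹ * ∫ s in Ioc 0 t, ∑ k ∈ F, Real.exp (-(lam * (t - s))) * transportWeight a u θ s k := by
        rw [← Finset.mul_sum, integral_finsetSum _ fun k _ => integrableOn_exp_mul_transportWeight hu hθ ha ht k]
    _ = (2 * κ)⁻¹ * ∫ s in Ioc 0 t, Real.exp (-(lam * (t - s))) * ∑ k ∈ F, transportWeight a u θ s k := by
        congr 1
        refine integral_congr_ae (ae_of_all _ fun s => ?_)
        dsimp only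
        rw [Finset.mul_sum]

/-- **The contraction bound.** For `κ, λ > 0`, `aᵢ > 0`, a drift bounded by `U` and a field with
`∫ θ(s)² ≤ E` on `[0,T]`: for every `t ∈ [0,T]` and every finite frequency set,
`∑_{k∈F} ‖D^λ(θ)(t)(k)‖² ≤ (∑ⱼ aⱼ⁻¹) U² E / (2κλ)` — the Duhamel term is bounded in
`L^∞_t ℓ²_k` by `q ‖θ‖_{L^∞_t L²_x}` with `q² = (∑ⱼaⱼ⁻¹)U²/(2κλ)`, small for `λ` large. [cite: Evans2010, §7.1.2 Thm. 2 (energy estimates), with Pazy1983 Ch. 4 §4.2 (2.3)] -/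
theorem sum_norm_sq_duhamelCoeff_le_const (hu : DriftBound T u U) (hθ : IsL2Field T E θ)
    (ha : ∀ i, 0 < a i) (hκ : 0 < κ) (hlam : 0 < lam) {t : ℝ} (ht : t ∈ Icc 0 T) (F : Finset (d → ℤ)) :
    ∑ k ∈ F, ‖duhamelCoeff κ a lam u θ t k‖ ^ 2 ≤ (∑ j, (a j)⁻¹) * U ^ 2 * E / (2 * κ * lam) := by
  set Cg : ℝ := (∑ j, (a j)⁻¹) * (U ^ 2 * E) with hCg
  have hE : 0 ≤ E := hθ.nonneg (ht.1.trans ht.2)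
  have hCg0 : 0 ≤ Cg := by
    have : 0 ≤ ∑ j, (a j)⁻¹ := Finset.sum_nonneg fun j _ => inv_nonneg.2 (ha j).le
    positivity
  refine (sum_norm_sq_duhamelCoeff_le hu hθ ha hκ hlam ht F).trans ?_
  have h1 : ∫ s in Ioc 0 t, Real.exp (-(lam * (t - s))) * ∑ k ∈ F, transportWeight a u θ s k ≤
      ∫ s in Ioc 0 t, Real.exp (-(lam * (t - s))) * Cg := by
    refine integral_mono_ae ?_ ?_ ?_
    · have e : (fun s => Real.exp (-(lam * (t - s))) * ∑ k ∈ F, transportWeight a u θ s k) =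
          fun s => ∑ k ∈ F, Real.exp (-(lam * (t - s))) * transportWeight a u θ s k := by
        funext s; rw [Finset.mul_sum]
      rw [e]
      exact integrable_finsetSum _ fun k _ => integrableOn_exp_mul_transportWeight hu hθ ha ht k
    · exact ((by fun_prop : Continuous fun s => Real.exp (-(lam * (t - s))) * Cg).integrableOn_Icc).mono_set
        Ioc_subset_Icc_self
    · filter_upwards [ae_restrict_Ioc_of_ae_restrict_Ioo ht.2 (ae_sum_transportWeight_le hu hθ ha)] with s hs
      exact mul_le_mul_of_nonneg_left (hs F) (Real.exp_pos _).le
  have h2 : ∫ s in Ioc 0 t, Real.exp (-(lam * (t - s))) * Cg ≤ lam⁻¹ * Cg := by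
    rw [integral_mul_const]
    exact mul_le_mul_of_nonneg_right (integral_Ioc_exp_neg_mul_sub_le hlam) hCg0
  calc (2 * κ)⁻¹ * ∫ s in Ioc 0 t, Real.exp (-(lam * (t - s))) * ∑ k ∈ F, transportWeight a u θ s k
      ≤ (2 * κ)⁻¹ * (lam⁻¹ * Cg) := mul_le_mul_of_nonneg_left (h1.trans h2) (by positivity)
    _ = (∑ j, (a j)⁻¹) * U ^ 2 * E / (2 * κ * lam) := by
        rw [hCg]
        field_simp

end Bounds

end Torus

end Literature.Analysis.FluidPDE

end
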